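import Summits.HodgeConjecture.HodgeConjecture.Theorems.Ring2AbelianAllAndreFibreClassDivision
import Summits.HodgeConjecture.HodgeConjecture.Theorems.Ring2AbelianAllAndreWeilSixfoldsMiddleDegree
import HarnessLib

/-!
# Ring 2 · sub-cell AbelianAll (ALL ABELIAN VARIETIES), André axis, part XXIX-c — THE BRACKET (Div): DIVISION BY THE
# FIBRE CLASS AS THE `A`-TYPE FORM OF THE FIBRE-CLASS LEFSCHETZ HYPOTHESIS; its place between (β′_f)/(A_f)/(N_p f)
# and the lift (L); rungs; on-path; the `HC_CM` row; W₆ from ONE "hom ≡ num" statement on the sevenfold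

HONEST FRAMING (page 1, verbatim): **research route, not a corollary; conditional on HC_CM plus one named
minimal statement.** Cell line: research route conditional on HC_CM; not a corollary; Q11.4-sentence-2
already refuted in dim ≥ 3. Nothing in this file proves a case of the Hodge conjecture for an abelian variety.
`HC_CM` = `Theses.RankFourFaces.CMAbelianHodge` is a BINDER in the one row where it occurs (§5);
`HC_AV` = `Theses.PadicSemiregularLift.HodgeAbelianVarieties`; `W₆` = `Theses.SevenfoldWeilCensus.WeilSixfolds`; item
`Theses.RankFourFaces.CMToAbelian` (stmt-HodgeConjecture-16267) OPEN and not closed here. Seat `pub-hodge-ring2-ab-andre-2`,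
gen 21; brief (ii) "replace `B` by algebraicity of specific … components — record each version" and (iii) "smallest open
instance stated as a find-the-cycle problem". Continuation of parts XXIX-a/b (`Ring2AbelianAllAndreFibreClassDivision[Family]`).

## The bracket (display-only `local notation3`, census-invisible; NOT a definition, NOT a node)

For a compact pencil `f : 𝒳 ⟶ S` of abelian `d`-folds, a point `t` and a degree `p`, with `L_t := j_{t*} ∘ j_t^*`
(`= · ∪ [𝒳_t]`, part V):
  `Div[hf, t, p]` :⟺ `L_t⁻¹ N^{p+1}(𝒳) ≤ N^p(𝒳) + ker j_t^*`
⟺ (`fibreClassDivisionAt_iff_forall_exists`) every `x ∈ H^{2p}(𝒳(ℂ); ℂ)` with `L_t x` ALGEBRAIC is `L_t x'` for an ALGEBRAIC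
`x'` — "an algebraic class divisible by the fibre class is divisible by it within algebraic classes",
`N^{p+1}(𝒳) ∩ [𝒳_t]·H^{2p}(𝒳) = [𝒳_t]·N^p(𝒳)`. Compare the lift (L)_t(p) of part XVII-b: `(j_t^*)⁻¹ N^p(𝒳_t) ≤ N^p(𝒳) + ker j_t^*`:
(L) pulls back algebraicity ON THE FIBRE along `j_t^*`, (Div) pulls back algebraicity ON THE TOTAL SPACE along `L_t`; since
`j_{t*}` preserves algebraic classes, `(j_t^*)⁻¹ N^p(𝒳_t) ≤ L_t⁻¹ N^{p+1}(𝒳)`, so (Div) ⟹ (L) by monotonicity. In the pair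
"(A_f) `L_t` has an algebraic quasi-inverse" (part X-b, the operator or `B`-shape, `⟺` (β′_f) since κ is a theorem) /
"(Div) division by the fibre class" (the class or `A`-shape) one recognises Grothendieck's `B(X)` / `A(X, L)` with the ample
class replaced by the (nef, square-zero) fibre class — seat ab-andre-1's part XIV did the same one level up, for `𝒳`'s own
ample class.

## What is proved (theorems only; no definition, no named fact, no sorry; `HC_CM` a binder in one row)

§1 forms: `fibreClassDivisionAt_iff_forall_exists`; `fiberGysin_map_fiberι_eq_of_points` (`L_t = L_s`: the fibre class is
constant, part XIII-e, a tree theorem); **`fibreClassDivisionAt_iff_of_points`** ((Div) is point-free).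
§2 edges (all kernel, per pencil/point/degree): **(N_p f)(t) ⟹ Div[t,p]**; **(A_f) ⟹ Div[t,p]** (`p ≤ d`); (β′_f) ⟹ Div;
**Div[t,p] ⟹ (L)_t(p)**; (Num₁) ∧ (Num₂) ⟹ Div (part XXIX-a); IN THE MIDDLE DEGREE `d = 2p` **(Num₂) ALONE ⟹ Div[t,p]**
(there (Num₁) is an instance of (Num₂)).
§3 rungs: Div[t,0], Div[t,d] (from (N₀), (N_d), part XIV-f) and Div[t,p] for `p > d` (vacuous) on EVERY compact abelian
pencil; hence every degree for `d ≤ 1`.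
§4 on-path: `HC(𝒳 × 𝒳) ⟹ Div[t,p]` (through (A_f), part X-b, with (φ_f) now a theorem), `HodgeConjecture ⟹ Div`.
§5 rows: `cmFibreAlgebraicLift_of_fibreClassDivision` ((Div) at the CM points ⟹ (L)); **`HC_AV_of_HC_CM_of_fibreClassDivision`**
(`h₂₁`, `HC_CM` binders); **`weilSixfolds_of_cmPowerWeilPencilsAt_of_fibreClassDivision_three`** (W₆ ⟸ (W_E)₃ ∧ Div[t₀,3] at
SOME point of each `E`-power-pointed sixfold pencil) and **`weilSixfolds_of_cmPowerWeilPencilsAt_of_numerical_three`**: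
W₆ ⟸ (W_E)₃ ∧ ONE STATEMENT PER SEVENFOLD — "an algebraic class `x ∪ [𝒳_t] ∈ N⁴(𝒳)` (`x ∈ H⁶(𝒳(ℂ); ℂ)`) cup-orthogonal to
`N³(𝒳)` is zero" (homological ≡ numerical equivalence for fibre-class-divisible codimension-`4` classes against codimension-`3`
classes on the `7`-fold); nonsplit twins.

## Honest status

Nothing here is fact-free progress on `HC_AV` or `W₆`; no node is born (the bracket is notation); nothing is minimal; no
separation between (Div), (L), (A_f), (N_p f) is claimed (modulo the Hodge conjecture they coincide). The first rung of
(Div) not settled here is `(d, p) = (2, 1)` IN THE KERNEL — in print it is unconditional (Lefschetz (1,1) on `𝒳_t` and on `𝒳`,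
Hodge types and rationality through `j_{t*}` on the invariant part), but the carriers' statement over `ℂ`-spans needs the
`ℚ`-structure of `L_t` and the Hodge type of `j_{t*}` on `Im j_t^*`, not assembled here; the first rung open in print is, as for
(L), the middle degree of abelian-fourfold pencils `(4, 2)` (Markman 2025 aside) and `(6, 3)` = W₆.

References: Grothendieck1968 (§3 p. 196); Kleiman1968AlgebraicCycles (§3, Cor. 3.9); Abdulali1994FamiliesAV (Conj. 5.3, Thm. 5.5,
p. 1130; p. 1122); Andre1996Motifs (Thm. 0.4, §5.1, Lemme 6.3.1, Lemme 6.3.3, Remarque 2); Milne2020HodgeClassesAV (Prop. 1 p. 7);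
FultonYoungTableaux1997 (App. B (5)–(6)); Fulton1998 (§19.1); HatcherAT2002 (§3.2 Thm. 3.11, §3.3 Thm. 3.26, Prop. 3.38);
DeligneHodgeII1971 (Thm. 4.1.1); VoisinHodgeII2003 (§4.3.1 Thm. 4.18, (10.7)); Voisin2025 (§3.2.2).
-/

noncomputable section

set_option linter.dupNamespace false

namespace Summit.HodgeConjecture.HodgeConjecture.Ring2.AbelianAll

open CategoryTheory AlgebraicGeometry MonoidalCategory
open Literature.AlgebraicGeometry Literature.AlgebraicGeometry.Motives
open Literature.AlgebraicGeometry.HodgeTheory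
open Literature.AlgebraicTopology.SingularHomology (singularCohomology cupProduct cupProduct_gradedComm_holds)
open Literature.AlgebraicGeometry.Deligne1982 (cmLocus)
open Literature.AlgebraicGeometry.Andre1996 (andre1996_cmAnchoredPencil)
open Summit.HodgeConjecture.HodgeConjecture
open Summit.HodgeConjecture.HodgeConjecture.Theses
open Summit.HodgeConjecture.HodgeConjecture.Ring2.Hypotheses (cmPowerLocus)
open Summit.HodgeConjecture.HodgeConjecture.WeilTypeLadder (NonsplitSixfolds nonsplitSixfolds_of_weilSixfolds)

variable {𝒳 S : SchemeOver ℂ} {d : ℕ} {f : 𝒳 ⟶ S}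

/-- **(Div) `Div[hf, t, p]` — DIVISION BY THE FIBRE CLASS at the point `t` in degree `2p`** on the compact pencil `hf` of
abelian `d`-folds `f : 𝒳 ⟶ S`: `L_t⁻¹ N^{p+1}(𝒳) ≤ N^p(𝒳) + ker j_t^*` with `L_t = j_{t*} j_t^*` (cup product with the fibre
class). DISPLAY-ONLY notation (census-invisible); a HYPOTHESIS wherever it occurs; open from `(d, p) = (4, 2)` in print.
[cite: Grothendieck1968, §3 p. 196 (A(X, L))] [cite: Abdulali1994FamiliesAV, Conjecture 5.3 (p. 1130)] -/
local notation3 "Div[" hf ", " t ", " p "]" =>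
  Submodule.comap ((fiberGysin hf t p) ∘ₗ (complexBetti.map (fiberι f t) (2 * p)).hom) (algebraicClasses 𝒳 (p + 1)) ≤
    algebraicClasses 𝒳 p ⊔ LinearMap.ker (complexBetti.map (fiberι f t) (2 * p)).hom

/-! ## §1 Forms of the bracket; it is point-free -/

/-- **(Div) in words: every `x` with `L_t x` algebraic is `L_t x'` with `x'` ALGEBRAIC** (`⟹`: `x = x' + k`, `j_t^* k = 0`;
`⟸`: `L_t(x - x') = 0` forces `j_t^*(x - x') = 0` by Deligne's kernel identity κ_f, a tree theorem).
[cite: DeligneHodgeII1971, Thm. 4.1.1] [cite: VoisinHodgeII2003, §4.3.1 Thm. 4.18] -/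
theorem fibreClassDivisionAt_iff_forall_exists (hf : IsCompactAbelianPencil f d) (t : ComplexPoints S) (p : ℕ) :
    Div[hf, t, p] ↔ ∀ x : complexBetti 𝒳 (2 * p),
      fiberGysin hf t p (complexBetti.map (fiberι f t) (2 * p) x) ∈ algebraicClasses 𝒳 (p + 1) →
        ∃ x' ∈ algebraicClasses 𝒳 p, fiberGysin hf t p (complexBetti.map (fiberι f t) (2 * p) x') =
          fiberGysin hf t p (complexBetti.map (fiberι f t) (2 * p) x) := by
  refine ⟨fun h x hx ↦ ?_, fun h x hx ↦ ?_⟩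
  · obtain ⟨x', hx', k, hk, hxk⟩ := Submodule.mem_sup.1 (h hx)
    refine ⟨x', hx', ?_⟩
    rw [LinearMap.mem_ker] at hk
    have hk' : complexBetti.map (fiberι f t) (2 * p) k = 0 := hk
    rw [← hxk, map_add, map_add, hk', map_zero, add_zero]
  · obtain ⟨x', hx', hL⟩ := h x hx
    have h0 : fiberGysin hf t p (complexBetti.map (fiberι f t) (2 * p) (x - x')) = 0 := by
      rw [map_sub, map_sub, sub_eq_zero, hL]
    have hk := fibreGysinKernelOn_holds hf p t t (x - x') h0
    rw [show x = x' + (x - x') by abel]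
    exact Submodule.add_mem_sup hx' (LinearMap.mem_ker.2 hk)

/-- **`L_t = L_s`**: `j_{t*} j_t^* x = j_{s*} j_s^* x` for all points `s, t` (both are cup product with the fibre class,
part V, and the fibre class of a compact pencil is constant, part XIII-e — tree theorems).
[cite: Fulton1998, §19.1 proof of Prop. 19.1.1] [cite: FultonYoungTableaux1997, Appendix B §B.1 (6)] -/
theorem fiberGysin_map_fiberι_eq_of_points (hf : IsCompactAbelianPencil f d) (t s : ComplexPoints S) {p : ℕ}
    (x : complexBetti 𝒳 (2 * p)) :
    fiberGysin hf t p (complexBetti.map (fiberι f t) (2 * p) x) = fiberGysin hf s p (complexBetti.map (fiberι f s) (2 * p) x) := by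
  rw [fiberGysin_map_fiberι_eq_cupProduct hf t x, fiberGysin_map_fiberι_eq_cupProduct hf s x, fibreClassConstantOn_holds hf t s]

/-- **(Div) IS POINT-FREE**: `Div[hf, t, p] ⟺ Div[hf, s, p]` for all `s, t` (`L_t = L_s`, and `N^p(𝒳) + ker j_t^*` does not
depend on `t`, part XVII-e). [cite: Fulton1998, §19.1 proof of Prop. 19.1.1] [cite: DeligneHodgeII1971, Thm. 4.1.1] -/
theorem fibreClassDivisionAt_iff_of_points (hf : IsCompactAbelianPencil f d) (t s : ComplexPoints S) (p : ℕ) :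
    Div[hf, t, p] ↔ Div[hf, s, p] := by
  have hL : (fiberGysin hf t p) ∘ₗ (complexBetti.map (fiberι f t) (2 * p)).hom =
      (fiberGysin hf s p) ∘ₗ (complexBetti.map (fiberι f s) (2 * p)).hom := by
    ext x
    exact fiberGysin_map_fiberι_eq_of_points hf t s x
  rw [hL, algebraicClasses_sup_ker_eq hf p t s]

/-! ## §2 Edges: (N_p f) ⟹ (Div) ⟸ (A_f) ⟸ (β′_f); (Div) ⟹ (L); (Num₁) ∧ (Num₂) ⟹ (Div); middle degree -/

/-- **(N_p f)(t) ⟹ Div[t, p]**: if EVERY invariant class of degree `2p` lifts to an algebraic class (part XIV-f's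
`AlgebraicInvariantClassesAt`), then in particular `j_t^* x = j_t^* D` with `D` algebraic, so `x ∈ N^p(𝒳) + ker j_t^*` — whatever
`L_t x` is. [cite: Abdulali1994FamiliesAV, Theorem 5.5 (p. 1130)] -/
theorem fibreClassDivisionAt_of_algebraicInvariantClassesAt (hf : IsCompactAbelianPencil f d) {t : ComplexPoints S} {p : ℕ}
    (h : AlgebraicInvariantClassesAt hf t p) : Div[hf, t, p] := by
  intro x _
  obtain ⟨D, hD, hDx⟩ := h x
  rw [show x = D + (x - D) by abel]
  refine Submodule.add_mem_sup hD (LinearMap.mem_ker.2 ?_)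
  change complexBetti.map (fiberι f t) (2 * p) (x - D) = 0
  rw [map_sub, hDx, sub_self]

/-- **(A_f) ⟹ Div[t, p] for `p ≤ d`**: with `T` an algebraic quasi-inverse of `L_t` (`L_t T L_t = L_t`), `x' := T(L_t x)` is
algebraic when `L_t x` is (algebraic correspondences preserve algebraic classes) and `L_t x' = L_t x`.
[cite: Abdulali1994FamiliesAV, Conjecture 5.3 and Remark 5.4 (p. 1130)] [cite: Kleiman1968AlgebraicCycles, §3] -/
theorem fibreClassDivisionAt_of_algebraicFibreClassQuasiInverseOn (hf : IsCompactAbelianPencil f d)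
    (h : AlgebraicFibreClassQuasiInverseOn hf) {p : ℕ} (hp : p ≤ d) (t : ComplexPoints S) : Div[hf, t, p] := by
  obtain ⟨T, hT, hTL⟩ := h p hp
  rw [fibreClassDivisionAt_iff_forall_exists]
  intro x hx
  exact ⟨T (fiberGysin hf t p (complexBetti.map (fiberι f t) (2 * p) x)),
    map_mem_algebraicClasses_of_isAlgebraicCorrespondence hf.isSmoothProjective_total hf.isSmoothProjective_total hT hx,
    hTL t x⟩

/-- **Div[t, p] for `p > d` (vacuous: `H^{2p}(𝒳_t) = 0`, so every `x` lies in `ker j_t^*`).** [cite: HatcherAT2002, §3.3 Thm. 3.26] -/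
theorem fibreClassDivisionAt_of_lt (hf : IsCompactAbelianPencil f d) {p : ℕ} (hp : d < p) (t : ComplexPoints S) :
    Div[hf, t, p] := by
  intro x _
  haveI := subsingleton_complexBetti (hf.isSmoothProjective_fiberOver t) (show 2 * d < 2 * p by omega)
  exact Submodule.mem_sup_right (LinearMap.mem_ker.2 (Subsingleton.elim _ _))

/-- **(A_f) ⟹ (Div) in every degree at every point.** [cite: Abdulali1994FamiliesAV, Conjecture 5.3 (p. 1130)] -/
theorem fibreClassDivisionAt_of_algebraicFibreClassQuasiInverseOn' (hf : IsCompactAbelianPencil f d)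
    (h : AlgebraicFibreClassQuasiInverseOn hf) (p : ℕ) (t : ComplexPoints S) : Div[hf, t, p] := by
  rcases le_or_gt p d with hp | hp
  · exact fibreClassDivisionAt_of_algebraicFibreClassQuasiInverseOn hf h hp t
  · exact fibreClassDivisionAt_of_lt hf hp t

/-- **(β′_f) ⟹ (Div)** (the repaired fibre-class Lefschetz node of part VIII contains (A_f), part X-b).
[cite: Abdulali1994FamiliesAV, Conjecture 5.3 (p. 1130)] [cite: Andre1996Motifs, Remarque 2 (p. 33)] -/
theorem fibreClassDivisionAt_of_fibreClassLefschetzOn (hf : IsCompactAbelianPencil f d) (h : FibreClassLefschetzOn hf)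
    (p : ℕ) (t : ComplexPoints S) : Div[hf, t, p] :=
  fibreClassDivisionAt_of_algebraicFibreClassQuasiInverseOn' hf ((fibreClassLefschetzOn_iff_kernel_and_quasiInverse hf).1 h).2 p t

/-- **Div[t, p] ⟹ (L)_t(p)**: `(j_t^*)⁻¹ N^p(𝒳_t) ≤ L_t⁻¹ N^{p+1}(𝒳)` because `j_{t*}` maps algebraic classes of the fibre to
algebraic classes of the total space (push-forward of cycles), so division gives the lift by monotonicity.
[cite: Milne2020HodgeClassesAV, Prop. 1 (p. 7)] [cite: Fulton1998, §19.1] -/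
theorem comap_le_sup_of_fibreClassDivisionAt (hf : IsCompactAbelianPencil f d) {t : ComplexPoints S} {p : ℕ}
    (h : Div[hf, t, p]) :
    (algebraicClasses (fiberOver f t) p).comap (complexBetti.map (fiberι f t) (2 * p)).hom ≤
      algebraicClasses 𝒳 p ⊔ LinearMap.ker (complexBetti.map (fiberι f t) (2 * p)).hom := by
  intro W hW
  have hW' : complexBetti.map (fiberι f t) (2 * p) W ∈ algebraicClasses (fiberOver f t) p := hW
  exact h (fiberGysin_mem_algebraicClasses hf t hW')

/-- **(Num₁) ∧ (Num₂) ⟹ Div[t, p]** (`p + q = d`; part XXIX-a's `exists_mem_algebraicClasses_map_fiberι_eq_of_numerical` in the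
bracket's form): two "hom ≡ num" statements on the TOTAL SPACE for fibre-class-divisible classes give division.
[cite: Kleiman1968AlgebraicCycles, §3 (D(X))] -/
theorem fibreClassDivisionAt_of_numerical (hf : IsCompactAbelianPencil f d) (t : ComplexPoints S) {p q : ℕ}
    (hpq : p + q = d)
    (hNum₁ : ∀ w ∈ algebraicClasses 𝒳 q,
      (∀ a ∈ algebraicClasses 𝒳 p, cupProduct (show 2 * p + 2 * (q + 1) = 2 * (d + 1) by omega) a
          (fiberGysin hf t q (complexBetti.map (fiberι f t) (2 * q) w)) = 0) →
        fiberGysin hf t q (complexBetti.map (fiberι f t) (2 * q) w) = 0)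
    (hNum₂ : ∀ x : complexBetti 𝒳 (2 * p),
      fiberGysin hf t p (complexBetti.map (fiberι f t) (2 * p) x) ∈ algebraicClasses 𝒳 (p + 1) →
      (∀ w ∈ algebraicClasses 𝒳 q, cupProduct (show 2 * (p + 1) + 2 * q = 2 * (d + 1) by omega)
          (fiberGysin hf t p (complexBetti.map (fiberι f t) (2 * p) x)) w = 0) →
        fiberGysin hf t p (complexBetti.map (fiberι f t) (2 * p) x) = 0) :
    Div[hf, t, p] := by
  intro x hx
  obtain ⟨x', hx', h⟩ := exists_mem_algebraicClasses_map_fiberι_eq_of_numerical hf t hpq hNum₁ hNum₂ hx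
  rw [show x = x' + (x - x') by abel]
  refine Submodule.add_mem_sup hx' (LinearMap.mem_ker.2 ?_)
  change complexBetti.map (fiberι f t) (2 * p) (x - x') = 0
  rw [map_sub, h, sub_self]

/-- **MIDDLE DEGREE `d = 2p`: (Num₂) ALONE ⟹ Div[t, p].** When `p = q` the hypothesis (Num₁) ("`L_t w`, `w ∈ N^p(𝒳)`,
orthogonal to `N^p(𝒳)` vanishes") is the instance `x := w` of (Num₂) (graded commutativity in even degrees), so ONE statement
remains: "an ALGEBRAIC class `x ∪ [𝒳_t] ∈ N^{p+1}(𝒳)` cup-orthogonal to `N^p(𝒳)` is zero" — homological ≡ numerical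
equivalence on the `(2p+1)`-fold `𝒳` for fibre-class-divisible classes of codimension `p + 1` against codimension `p`.
The case `(d, p) = (6, 3)` is the W₆ statement of §5. [cite: Kleiman1968AlgebraicCycles, §3 (D(X))] [cite: HatcherAT2002, §3.2 Thm. 3.11] -/
theorem fibreClassDivisionAt_middle_of_numerical (hf : IsCompactAbelianPencil f d) (t : ComplexPoints S) {p : ℕ}
    (hp : p + p = d)
    (hNum : ∀ x : complexBetti 𝒳 (2 * p),
      fiberGysin hf t p (complexBetti.map (fiberι f t) (2 * p) x) ∈ algebraicClasses 𝒳 (p + 1) →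
      (∀ w ∈ algebraicClasses 𝒳 p, cupProduct (show 2 * (p + 1) + 2 * p = 2 * (d + 1) by omega)
          (fiberGysin hf t p (complexBetti.map (fiberι f t) (2 * p) x)) w = 0) →
        fiberGysin hf t p (complexBetti.map (fiberι f t) (2 * p) x) = 0) :
    Div[hf, t, p] := by
  refine fibreClassDivisionAt_of_numerical hf t hp (fun w hw horth ↦ ?_) hNum
  refine hNum w (fiberGysin_mem_algebraicClasses hf t (algebraicClasses_sup_ker_le_comap hf p t (Submodule.mem_sup_left hw)))
    fun w' hw' ↦ ?_
  rw [cupProduct_gradedComm_holds ℂ (ComplexPoints 𝒳) (show 2 * (p + 1) + 2 * p = 2 * (d + 1) by omega)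
    (show 2 * p + 2 * (p + 1) = 2 * (d + 1) by omega), Even.neg_one_pow ⟨2 * (p + 1) * p, by ring⟩, one_smul]
  exact horth w' hw'

/-! ## §3 Rungs: the extreme degrees and `d ≤ 1`, on every compact abelian pencil -/

/-- **Div[t, 0] holds** (`H⁰(𝒳)` is algebraic; (N₀) of part XIV-f). [folklore] -/
theorem fibreClassDivisionAt_zero (hf : IsCompactAbelianPencil f d) (t : ComplexPoints S) : Div[hf, t, 0] :=
  fibreClassDivisionAt_of_algebraicInvariantClassesAt hf (algebraicInvariantClassesAt_zero hf t)

/-- **Div[t, d] holds** (the top degree of the fibre is the line through `K_tᵈ`, `K` an algebraic global polarisation; (N_d) of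
part XIV-f). [cite: VoisinHodgeI2002, §6.2.3 Thm. 6.25] [cite: HatcherAT2002, §3.3 Thm. 3.26] -/
theorem fibreClassDivisionAt_top (hf : IsCompactAbelianPencil f d) (t : ComplexPoints S) : Div[hf, t, d] :=
  fibreClassDivisionAt_of_algebraicInvariantClassesAt hf (algebraicInvariantClassesAt_top hf t)

/-- **Every degree for pencils of relative dimension `d ≤ 1`** (elliptic pencils: only the degrees `0, d` and the vacuous ones occur).
[cite: HatcherAT2002, §3.3 Thm. 3.26] -/
theorem fibreClassDivisionAt_of_relDim_le_one (hf : IsCompactAbelianPencil f d) (hd : d ≤ 1) (p : ℕ) (t : ComplexPoints S) :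
    Div[hf, t, p] := by
  rcases Nat.lt_or_ge d p with hp | hp
  · exact fibreClassDivisionAt_of_lt hf hp t
  · interval_cases d
    · obtain rfl : p = 0 := by omega
      exact fibreClassDivisionAt_zero hf t
    · rcases Nat.le_one_iff_eq_zero_or_eq_one.1 hp with rfl | rfl
      · exact fibreClassDivisionAt_zero hf t
      · exact fibreClassDivisionAt_top hf t

/-! ## §4 On-path: the Hodge conjecture for `𝒳 × 𝒳` gives (Div) -/

/-- **`HC(𝒳 × 𝒳) ⟹ Div[t, p]`** for every `t, p`: the Hodge conjecture for the `(2d+2)`-fold `𝒳 × 𝒳` gives (A_f) (part X-b,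
modulo the fibre-class constancy (φ_f), which is now a tree theorem, part XIII-e), hence (Div). So (Div) is a CASE of the summit.
[cite: Andre1996Motifs, §6.3 Remarque 2 (p. 33)] [cite: Voisin2025, §3.2.2] -/
theorem fibreClassDivisionAt_of_hodgeConjectureFor (hf : IsCompactAbelianPencil f d)
    (hHC : HodgeConjectureFor ((d + 1) + (d + 1)) (𝒳 ⊗ 𝒳)) (p : ℕ) (t : ComplexPoints S) : Div[hf, t, p] :=
  fibreClassDivisionAt_of_algebraicFibreClassQuasiInverseOn' hf
    (algebraicFibreClassQuasiInverseOn_of_hodgeConjectureFor hf (fibreClassConstantOn_holds hf) hHC) p t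

/-- **`HodgeConjecture ⟹ Div[t, p]`** (the summit statement applied to `𝒳 × 𝒳`). [cite: Andre1996Motifs, §6.3 Remarque 2 (p. 33)] -/
theorem fibreClassDivisionAt_of_hodgeConjecture (hf : IsCompactAbelianPencil f d) (h : _root_.HodgeConjecture) (p : ℕ)
    (t : ComplexPoints S) : Div[hf, t, p] :=
  fibreClassDivisionAt_of_hodgeConjectureFor hf
    (h (IsSmoothProjective.tensor_holds hf.isSmoothProjective_total hf.isSmoothProjective_total)) p t

/-! ## §5 Rows: (Div) at the CM points gives (L); the `HC_CM` row; W₆ from ONE statement per sevenfold -/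

/-- **(Div) at the CM points of the CM-pointed compact abelian pencils ⟹ (L) = `CMFibreAlgebraicLift`** (the André-axis lift
node, part IV). [cite: Andre1996Motifs, Lemme 6.3.1 (p. 31) and Remarque 2 (p. 33)] [cite: Milne2020HodgeClassesAV, Prop. 1 (p. 7)] -/
theorem cmFibreAlgebraicLift_of_fibreClassDivision
    (h : ∀ ⦃d : ℕ⦄ ⦃𝒳 S : SchemeOver ℂ⦄ (f : 𝒳 ⟶ S) (hf : IsCompactAbelianPencil f d) (p : ℕ), ∀ t ∈ cmLocus f d,
      Submodule.comap ((fiberGysin hf t p) ∘ₗ (complexBetti.map (fiberι f t) (2 * p)).hom) (algebraicClasses 𝒳 (p + 1)) ≤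
        algebraicClasses 𝒳 p ⊔ LinearMap.ker (complexBetti.map (fiberι f t) (2 * p)).hom) :
    CMFibreAlgebraicLift := by
  rw [cmFibreAlgebraicLift_iff_comap_le_sup]
  intro d 𝒳 S f hf p t ht
  exact comap_le_sup_of_fibreClassDivisionAt hf (h f hf p t ht)

/-- **Row `HC_CM ∧ (Div at the CM points) ⟹ HC_AV`** (`h₂₁` = Lemme 6.3.1 and `HC_CM` BINDERS; `HC_CM` serves the transport
at the CM fibre, not the division). The `A`-type sibling of part VIII's `HC_CM ∧ (β′) ⟹ HC_AV`.
[cite: Andre1996Motifs, Lemme 6.3.1 (p. 31) and Remarque 2 (p. 33)] [cite: Milne2020HodgeClassesAV, Prop. 1 (p. 7)] -/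
theorem HC_AV_of_HC_CM_of_fibreClassDivision (h₂₁ : andre1996_cmAnchoredPencil) (hCM : RankFourFaces.CMAbelianHodge)
    (h : ∀ ⦃d : ℕ⦄ ⦃𝒳 S : SchemeOver ℂ⦄ (f : 𝒳 ⟶ S) (hf : IsCompactAbelianPencil f d) (p : ℕ), ∀ t ∈ cmLocus f d,
      Submodule.comap ((fiberGysin hf t p) ∘ₗ (complexBetti.map (fiberι f t) (2 * p)).hom) (algebraicClasses 𝒳 (p + 1)) ≤
        algebraicClasses 𝒳 p ⊔ LinearMap.ker (complexBetti.map (fiberι f t) (2 * p)).hom) :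
    PadicSemiregularLift.HodgeAbelianVarieties :=
  HC_AV_of_HC_CM_and_cmFibreAlgebraicLift h₂₁ hCM (cmFibreAlgebraicLift_of_fibreClassDivision h)

/-- **W₆ ⟸ (W_E)₃ ∧ Div[t₀, 3] AT SOME POINT of every `E`-power-pointed compact pencil of Weil-type sixfolds** ((Div) is
point-free, §1; Div ⟹ (L) at the `E`-power points; part XXVIII-e's `weilSixfolds_of_cmPowerWeilPencilsAt_of_lift_three`). FIND THE
CYCLE: on the sevenfold `𝒳`, for `x ∈ H⁶(𝒳(ℂ); ℂ)` with `x ∪ [𝒳_t]` the class of an algebraic `3`-cycle (e.g. the push-forward of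
a cycle representing an invariant Weil class on the `E`-power fibre), a codimension-`3` algebraic cycle `W` with `[W] ∪ [𝒳_t] = x ∪ [𝒳_t]`.
`HC_CM` does not occur. [cite: Andre1996Motifs, Lemme 6.3.3 (p. 33)] [cite: Abdulali1994FamiliesAV, Conjecture 5.3 (p. 1130)] -/
theorem weilSixfolds_of_cmPowerWeilPencilsAt_of_fibreClassDivision_three (hW : CMPowerAnchoredCompactWeilPencilsAt 3)
    (hDiv : ∀ ⦃𝒳 S : SchemeOver ℂ⦄ ⦃f : 𝒳 ⟶ S⦄ (hf : IsCompactAbelianPencil f 6), (cmPowerLocus f 6).Nonempty →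
      ∃ t₀ : ComplexPoints S,
        Submodule.comap ((fiberGysin hf t₀ 3) ∘ₗ (complexBetti.map (fiberι f t₀) (2 * 3)).hom) (algebraicClasses 𝒳 (3 + 1)) ≤
          algebraicClasses 𝒳 3 ⊔ LinearMap.ker (complexBetti.map (fiberι f t₀) (2 * 3)).hom) :
    Theses.SevenfoldWeilCensus.WeilSixfolds := by
  refine weilSixfolds_of_cmPowerWeilPencilsAt_of_lift_three hW fun 𝒳 S f hf t ht ↦ ?_
  obtain ⟨t₀, h₀⟩ := hDiv hf ⟨t, ht⟩
  exact comap_le_sup_of_fibreClassDivisionAt hf ((fibreClassDivisionAt_iff_of_points hf t₀ t 3).1 h₀)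

/-- The same for the NON-SPLIT sixfolds. [cite: Andre1996Motifs, Lemme 6.3.3 (p. 33)] -/
theorem nonsplitSixfolds_of_cmPowerWeilPencilsAt_of_fibreClassDivision_three (hW : CMPowerAnchoredCompactWeilPencilsAt 3)
    (hDiv : ∀ ⦃𝒳 S : SchemeOver ℂ⦄ ⦃f : 𝒳 ⟶ S⦄ (hf : IsCompactAbelianPencil f 6), (cmPowerLocus f 6).Nonempty →
      ∃ t₀ : ComplexPoints S,
        Submodule.comap ((fiberGysin hf t₀ 3) ∘ₗ (complexBetti.map (fiberι f t₀) (2 * 3)).hom) (algebraicClasses 𝒳 (3 + 1)) ≤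
          algebraicClasses 𝒳 3 ⊔ LinearMap.ker (complexBetti.map (fiberι f t₀) (2 * 3)).hom) :
    NonsplitSixfolds :=
  nonsplitSixfolds_of_weilSixfolds (weilSixfolds_of_cmPowerWeilPencilsAt_of_fibreClassDivision_three hW hDiv)

/-- **W₆ ⟸ (W_E)₃ ∧ ONE "HOM ≡ NUM" STATEMENT PER SEVENFOLD**: for every `E`-power-pointed compact pencil `f : 𝒳 ⟶ S` of
Weil-type abelian sixfolds and some point `t₀`: "every ALGEBRAIC class `x ∪ [𝒳_{t₀}] ∈ N⁴(𝒳)` (`x ∈ H⁶(𝒳(ℂ); ℂ)`) that is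
cup-orthogonal to `N³(𝒳)` vanishes" — homological ≡ numerical equivalence on the `7`-fold for fibre-class-divisible
codimension-`4` classes against codimension-`3` classes (§2, middle degree). No correspondence, no lift, no fibre cohomology in
the hypothesis; `HC_CM` does not occur (Tate at the `E`-power fibre, part IX). [cite: Kleiman1968AlgebraicCycles, §3 (D(X))]
[cite: Andre1996Motifs, Lemme 6.3.3 (p. 33)] -/
theorem weilSixfolds_of_cmPowerWeilPencilsAt_of_numerical_three (hW : CMPowerAnchoredCompactWeilPencilsAt 3)
    (hNum : ∀ ⦃𝒳 S : SchemeOver ℂ⦄ ⦃f : 𝒳 ⟶ S⦄ (hf : IsCompactAbelianPencil f 6), (cmPowerLocus f 6).Nonempty →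
      ∃ t₀ : ComplexPoints S, ∀ x : complexBetti 𝒳 (2 * 3),
        fiberGysin hf t₀ 3 (complexBetti.map (fiberι f t₀) (2 * 3) x) ∈ algebraicClasses 𝒳 (3 + 1) →
        (∀ w ∈ algebraicClasses 𝒳 3, cupProduct (show 2 * (3 + 1) + 2 * 3 = 2 * (6 + 1) by omega)
            (fiberGysin hf t₀ 3 (complexBetti.map (fiberι f t₀) (2 * 3) x)) w = 0) →
          fiberGysin hf t₀ 3 (complexBetti.map (fiberι f t₀) (2 * 3) x) = 0) :
    Theses.SevenfoldWeilCensus.WeilSixfolds := by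
  refine weilSixfolds_of_cmPowerWeilPencilsAt_of_fibreClassDivision_three hW fun 𝒳 S f hf hne ↦ ?_
  obtain ⟨t₀, h₀⟩ := hNum hf hne
  exact ⟨t₀, fibreClassDivisionAt_middle_of_numerical hf t₀ (show 3 + 3 = 6 by omega) h₀⟩

/-- The same for the NON-SPLIT sixfolds. [cite: Andre1996Motifs, Lemme 6.3.3 (p. 33)] -/
theorem nonsplitSixfolds_of_cmPowerWeilPencilsAt_of_numerical_three (hW : CMPowerAnchoredCompactWeilPencilsAt 3)
    (hNum : ∀ ⦃𝒳 S : SchemeOver ℂ⦄ ⦃f : 𝒳 ⟶ S⦄ (hf : IsCompactAbelianPencil f 6), (cmPowerLocus f 6).Nonempty →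
      ∃ t₀ : ComplexPoints S, ∀ x : complexBetti 𝒳 (2 * 3),
        fiberGysin hf t₀ 3 (complexBetti.map (fiberι f t₀) (2 * 3) x) ∈ algebraicClasses 𝒳 (3 + 1) →
        (∀ w ∈ algebraicClasses 𝒳 3, cupProduct (show 2 * (3 + 1) + 2 * 3 = 2 * (6 + 1) by omega)
            (fiberGysin hf t₀ 3 (complexBetti.map (fiberι f t₀) (2 * 3) x)) w = 0) →
          fiberGysin hf t₀ 3 (complexBetti.map (fiberι f t₀) (2 * 3) x) = 0) :
    NonsplitSixfolds :=
  nonsplitSixfolds_of_weilSixfolds (weilSixfolds_of_cmPowerWeilPencilsAt_of_numerical_three hW hNum)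

end Summit.HodgeConjecture.HodgeConjecture.Ring2.AbelianAll

end
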